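import Summits.BirchSwinnertonDyer.BirchSwinnertonDyer.Theorems.ByReductionTypeAtTwoGoodOrdTowerEpsKummer
import Summits.BirchSwinnertonDyer.BirchSwinnertonDyer.Theorems.ByReductionTypeAtTwoGoodOrdTowerKernel
import Summits.BirchSwinnertonDyer.BirchSwinnertonDyer.Theorems.ByReductionTypeAtTwoMultTowerNS2TowerCosets
import Summits.BirchSwinnertonDyer.BirchSwinnertonDyer.Theorems.ByReductionTypeAtTwoMultTowerNS2TateUnitAtTwo
import HarnessLib

/-!
# Route `ByReductionTypeAtTwo`, item `OrdKatoHalfAtTwo` (stmt-BirchSwinnertonDyer-19271), TOWER road, the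
# GOOD-ORDINARY local constant at `v ∣ 2`: KERNEL BRICK ε3 — the `2`-torsion package at a good ordinary `2`, and the
# KUMMER ENDGAME «conjugation law `a^g = a + χ_Δ` ⇒ `±Δ` is a relative norm in the tower ⇒ contradiction»

HONEST FRAMING (cell `bsd-2adic`, run/shared/lean/pub/bsd-2adic/, seat `bsd-2adic-tower-1` GEN 18, HUMAN RULINGS
D-0036 / D-0054 / D-0074; wake item «IMC-LKε kernelisation», planner RC-201, HOME/plan/WAKE-IDLE-2ADIC-IMC-LKeps-kernelisation.md):
TOOL theorems only (no definition, no named fact, no `sorry`); closes nothing by itself; nothing booked; BSD is not proved by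
any of this. Third brick of the ε-REFINEMENT of the GEN 11 kernel theorem `GoodOrdTower.pTorsion_localTowerKer_at_two_le_four_kernel`
to `≤ 2` under `Δ_min ≡ ±3 (mod 8)` (cell `bsd-f1-sign2`'s IMC-LKε⁻≤, `F1Sign2.LocalKernelOneBitOffNormAtTwoLe`; MEMO-imc §10.45).
Setting: `W/ℚ` globally minimal, good ordinary at `2`, `κ` cyclotomic, `v ∋ 2`, `K = ℚ_v`, `Γ = Gal(K̄_v/K)`, `H_m`, `H_∞`
the local tower subgroups, `g` a topological generator of `H_n` over `H_∞`, `red₀ : E(K̄_v) → Ẽ(k̄)`.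

* `toZModPow_three_intCast_of_emod_eight` — `m ≡ 3, 5 (mod 8)` read in `ℤ₂/8`, for `m` AND `−m` (the class is sign-stable).
* `localPoints.exists_eq_some_of_ne_zero` — a nonzero point of `E(K̄_v)` has coordinates.
* **`goodOrd_two_torsion_package`** — at a good ORDINARY `2`: the formal group `ker red₀` is `Γ`-stable and `2`-divisible;
  its `2`-torsion is `{0, P₁}` with `P₁ ≠ 0` RATIONAL (`σ P₁ = P₁` for all `σ ∈ Γ`); a `2`-torsion point with NONZERO reduction
  is moved by every `σ ∈ Γ` by `0` or `P₁` (`#Ẽ(k̄)[2] ≤ 2`); hence `σ²` fixes every point of `E(K̄_v)[2]` (the image of `Γ` in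
  `Aut E[2] ≅ S₃` fixes `P₁`, so has exponent `2`). Assembled from GEN 11's BRICK G4 (`…GoodOrdTowerHensel`) and the tree's
  `localRed_ordinary_filtration`.
* **`false_of_kummer_conjugation_law`** — THE KUMMER ENDGAME of the ε-step. Data: a continuous character `a : H_{n+1} → ℤ/2`,
  a function `χ : Γ → ℤ/2` and `s ∈ K̄_v` with `s² = m ∈ ℤ`, `m ≡ 3, 5 (mod 8)`, `σ s = (−1)^{χ(σ)} s` for all `σ ∈ Γ`, and the
  CONJUGATION LAW `a(g⁻¹τg) = a(τ) + χ(τ)` on `H_{n+1}`. Conclusion: `False`. Proof: Hilbert 90 (BRICK ε2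
  `exists_smul_eq_ite_neg_of_contHom`) gives `β ≠ 0` with `τβ = (−1)^{a(τ)}β` on `H_{n+1}`; `θ := β·gβ·s` and `β²` are
  `H_{n+1}`-fixed, `θ² = β²·g(β²)·s²` (as `g² ∈ H_{n+1}`), so `gθ = ±θ`, and `f := β²s²/θ` is `H_{n+1}`-fixed with
  `f·g(f) = ±s² = ±m`: this contradicts NS2 BRICK 15 `MultTowerNS2.prod_smul_ne_pow_of_tateUnit` (`k = 0`, `R = 1`, unit `±m`).

References: R. Greenberg, LNM 1716 (1999), §2, §3 Lemma 3.4 (p. 89); K. Kramer, Trans. AMS 264 (1981), Prop. 5 (p. 127);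
J.-P. Serre, *Local Fields* X §1 Prop. 2; J. Neukirch, *ANT* V (1.1); cell memos pub/bsd-f1-sign2/MEMO-imc.md §10.45–§10.46.
-/

set_option autoImplicit false
-- the Theorems namespace of this sub repeats the summit name by design (D-0017 nested layout: Summit.<S>.<Sub>)
set_option linter.dupNamespace false

noncomputable section

open scoped Classical NNReal

namespace Summit.BirchSwinnertonDyer.BirchSwinnertonDyer.Theorems.GoodOrdTower

open NumberField IsDedekindDomain Field PadicInt Literature.NumberTheory.EllipticCurves
  Literature.NumberTheory.GaloisRepresentations IsDedekindDomain.HeightOneSpectrum Rat.HeightOneSpectrum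
  Literature.NumberTheory.EllipticCurves.FormalGroupChart Literature.NumberTheory.EllipticCurves.ResKernel
  Literature.NumberTheory.EllipticCurves.Rank1Residual WeierstrassCurve

/-- `m ≡ 3, 5 (mod 8)` in `ℤ₂/8ℤ₂`, for `m` and for `−m` (the class `{3, 5} ⊂ (ℤ/8)ˣ` is stable under negation). [folklore] -/
theorem toZModPow_three_intCast_of_emod_eight (p : ℕ) [Fact p.Prime] (hp : p = 2) (m : ℤ)
    (hm : m % 8 = 3 ∨ m % 8 = 5) :
    (toZModPow 3 ((m : ℤ) : ℤ_[p]) = 3 ∨ toZModPow 3 ((m : ℤ) : ℤ_[p]) = 5) ∧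
      (toZModPow 3 ((-m : ℤ) : ℤ_[p]) = 3 ∨ toZModPow 3 ((-m : ℤ) : ℤ_[p]) = 5) := by
  subst hp
  have h8 : ∀ k : ℤ, toZModPow 3 ((k : ℤ) : ℤ_[2]) = ((k % 8 : ℤ) : ZMod (2 ^ 3)) := fun k ↦ by
    rw [map_intCast]
    exact (ZMod.intCast_mod k (2 ^ 3)).symm
  have hneg : (-m) % 8 = 5 ∨ (-m) % 8 = 3 := by omega
  refine ⟨?_, ?_⟩
  · rw [h8]
    rcases hm with h | h
    · left; rw [h]; rfl
    · right; rw [h]; rfl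
  · rw [h8]
    rcases hneg with h | h
    · right; rw [h]; rfl
    · left; rw [h]; rfl

/-- A nonzero point of `E(K̄_v)` is an affine point with coordinates. [folklore] -/
theorem localPoints.exists_eq_some_of_ne_zero {K : Type} [Field K] (W : WeierstrassCurve ℚ) [Algebra ℚ K]
    (Q : localPoints W K) (hQ : Q ≠ 0) :
    ∃ (x y : AlgebraicClosure K) (h : (W.baseChange (AlgebraicClosure K)).toAffine.Nonsingular x y),
      Q = Affine.Point.some x y h := by
  change (W.baseChange (AlgebraicClosure K)).toAffine.Point at Q
  rcases Q with _ | ⟨x, y, h⟩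
  · exact absurd rfl hQ
  · exact ⟨x, y, h, rfl⟩

/-! ### The `2`-torsion package at a good ordinary `2` -/

/-- **The `2`-torsion package at a good ORDINARY `2`.** For `W/ℚ` globally minimal, good ordinary at `2`, `v ∋ 2` and the
reduction map `red₀ : E(K̄_v) → Ẽ(k̄)` of the local integral model: `ker red₀` is `Γ`-stable and `2`-divisible, and there is
`P₁ ∈ ker red₀` with `2P₁ = 0`, `P₁ ≠ 0`, FIXED by `Γ = Gal(K̄_v/ℚ_v)`, such that `(ker red₀)[2] = {0, P₁}`, every `2`-torsion
point with nonzero reduction is moved by each `σ ∈ Γ` by `0` or by `P₁` (two nonzero `2`-torsion reductions coincide, as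
`#Ẽ(k̄)[2] ≤ 2`), and consequently `σ² Q = Q` for every `Q ∈ E(K̄_v)[2]`. (Assembly of BRICK G4 and the ordinary filtration.)
[cite: GreenbergLNM1716, §2 Props. 2.2–2.4 (pp. 76–80)] [cite: SilvermanAEC2009, VII.2.1, VII.3.1] -/
theorem goodOrd_two_torsion_package (W : WeierstrassCurve ℚ) [W.IsGloballyMinimal] [W.IsElliptic] (hgo : GoodOrd W 2)
    (v : HeightOneSpectrum (𝓞 ℚ)) (h2v : ((2 : ℕ) : 𝓞 ℚ) ∈ v.asIdeal)
    {w : Valuation (AlgebraicClosure (v.adicCompletion ℚ)) ℝ≥0}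
    (hw : ∀ z, (w z : ℝ) = spectralNorm (v.adicCompletion ℚ) (AlgebraicClosure (v.adicCompletion ℚ)) z)
    (red₀ : localPoints W (v.adicCompletion ℚ) →+
      (((integralModelInt W).map (algebraMap ℤ ↥w.valuationSubring)).map
        (IsLocalRing.residue ↥w.valuationSubring)).toAffine.Point)
    (hred₀ : ∀ P : localPoints W (v.adicCompletion ℚ), red₀ P =
      ((integralModelInt W).map (algebraMap ℤ ↥w.valuationSubring)).reducePoint
        (Affine.Point.congrEquiv (localIntModel_baseChange W w.valuationSubring).symm P)) :
    (∀ (σ : absoluteGaloisGroup (v.adicCompletion ℚ)) (Q : localPoints W (v.adicCompletion ℚ)),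
        red₀ Q = 0 → red₀ (σ • Q) = 0) ∧
    (∀ a : localPoints W (v.adicCompletion ℚ), red₀ a = 0 →
        ∃ b : localPoints W (v.adicCompletion ℚ), red₀ b = 0 ∧ 2 • b = a) ∧
    ∃ P₁ : localPoints W (v.adicCompletion ℚ), red₀ P₁ = 0 ∧ 2 • P₁ = 0 ∧ P₁ ≠ 0 ∧
      (∀ σ : absoluteGaloisGroup (v.adicCompletion ℚ), σ • P₁ = P₁) ∧
      (∀ a : localPoints W (v.adicCompletion ℚ), red₀ a = 0 → 2 • a = 0 → a = 0 ∨ a = P₁) ∧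
      (∀ (σ : absoluteGaloisGroup (v.adicCompletion ℚ)) (a : localPoints W (v.adicCompletion ℚ)),
        2 • a = 0 → red₀ a ≠ 0 → σ • a - a = 0 ∨ σ • a - a = P₁) ∧
      (∀ a : localPoints W (v.adicCompletion ℚ), 2 • a = 0 →
        ∀ σ : absoluteGaloisGroup (v.adicCompletion ℚ), (σ ^ 2) • a = a) := by
  let K := v.adicCompletion ℚ
  let Kb := AlgebraicClosure (v.adicCompletion ℚ)
  let P : Type := localPoints W K
  haveI : Fact (Nat.Prime 2) := ⟨Nat.prime_two⟩
  have hord : W.HasGoodReductionAtPrime 2 ∧ ¬ ((2 : ℕ) : ℤ) ∣ W.frobeniusTrace 2 := hgo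
  have hΔ : ¬ ((2 : ℕ) : ℤ) ∣ minimalDiscriminantInt W :=
    W.not_dvd_minimalDiscriminantInt_of_hasGoodReductionAtPrime' 2 hord.1
  have hap := hord.2
  have hvO : w.Integers w.valuationSubring := Valuation.valuationSubring.integers w
  have hΔu := W.isUnit_Δ_localIntModel h2v hw hΔ
  have hpO : w ((2 : ℕ) : Kb) < 1 := by
    have h := spectralValuation_algebraMap_ringOfIntegers_lt_one (v := v) hw h2v
    rwa [map_natCast] at h
  haveI hchar : CharP (IsLocalRing.ResidueField ↥w.valuationSubring) 2 := by
    refine (CharP.charP_iff_prime_eq_zero Nat.prime_two).mpr ?_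
    rw [← map_natCast (IsLocalRing.residue ↥w.valuationSubring), IsLocalRing.residue_eq_zero_iff,
      IsLocalRing.mem_maximalIdeal, mem_nonunits_iff, hvO.isUnit_iff_valuation_eq_one, map_natCast]
    exact ne_of_lt hpO
  -- the ordinary filtration: `P₁`, `A₁[2] = {0, P₁}`, divisibility of the formal group
  have hordA := W.exists_zsmul_eq_zero_localRed_ne_zero hw hΔu red₀ hred₀ h2v hΔ hap
  obtain ⟨hgenr, -, hdiv₁⟩ := W.localRed_ordinary_filtration hΔu red₀ hred₀ hordA
  obtain ⟨P₁, hP₁0, hP₁ord, hP₁gen⟩ := hgenr 1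
  rw [pow_one] at hP₁ord hP₁gen
  have hP₁two : 2 • P₁ = 0 := by rw [← hP₁ord]; exact addOrderOf_nsmul_eq_zero P₁
  have hP₁ne : P₁ ≠ 0 := fun h ↦ by
    rw [h, addOrderOf_zero] at hP₁ord; exact absurd hP₁ord (by norm_num)
  have hstab : ∀ (σ : absoluteGaloisGroup K) (Q : P), red₀ Q = 0 → red₀ (σ • Q) = 0 :=
    fun σ Q hQ ↦ (W.localRed_smul_eq_zero_iff hw hΔu red₀ hred₀ σ Q).mpr hQ
  have hstab' : ∀ (σ : absoluteGaloisGroup K) (Q : P), red₀ Q ≠ 0 → red₀ (σ • Q) ≠ 0 := fun σ Q hQ h ↦ by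
    have h' := hstab σ⁻¹ (σ • Q) h
    rw [← mul_smul, inv_mul_cancel, one_smul] at h'
    exact hQ h'
  have hA12 : ∀ a : P, red₀ a = 0 → 2 • a = 0 → a = 0 ∨ a = P₁ := by
    intro a ha h2a
    obtain ⟨c, rfl⟩ := hP₁gen a ha (by rw [natCast_zsmul]; exact h2a)
    rcases Nat.even_or_odd c with ⟨k, rfl⟩ | ⟨k, rfl⟩
    · left; rw [← two_mul, mul_comm, mul_nsmul', hP₁two, nsmul_zero]
    · right; rw [add_nsmul, mul_comm, mul_nsmul', hP₁two, nsmul_zero, zero_add, one_nsmul]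
  have hP₁fix : ∀ σ : absoluteGaloisGroup K, σ • P₁ = P₁ := fun σ ↦ by
    rcases hA12 (σ • P₁) (hstab σ P₁ hP₁0) (by rw [← smul_comm, hP₁two, smul_zero]) with h | h
    · exact absurd (smul_eq_zero_iff_eq σ |>.mp h) hP₁ne
    · exact h
  -- `#Ẽ(k̄)[2] ≤ 2`: two nonzero `2`-torsion reductions coincide
  obtain ⟨hfinT, hT⟩ := finite_torsionBy_localRed_target_and_card_le W hΔu red₀ hred₀ hordA
  haveI := hfinT
  have hTuniq : ∀ t t' : (((integralModelInt W).map (algebraMap ℤ ↥w.valuationSubring)).map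
      (IsLocalRing.residue ↥w.valuationSubring)).toAffine.Point,
      2 • t = 0 → 2 • t' = 0 → t ≠ 0 → t' ≠ 0 → t = t' := by
    intro t t' ht ht' ht0 ht'0
    by_contra hne
    haveI := Fintype.ofFinite {s : (((integralModelInt W).map (algebraMap ℤ ↥w.valuationSubring)).map
      (IsLocalRing.residue ↥w.valuationSubring)).toAffine.Point // 2 • s = 0}
    have hcard := hT
    rw [Nat.card_eq_fintype_card] at hcard
    have h3 : 2 < Fintype.card {s : (((integralModelInt W).map (algebraMap ℤ ↥w.valuationSubring)).map
        (IsLocalRing.residue ↥w.valuationSubring)).toAffine.Point // 2 • s = 0} :=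
      Fintype.two_lt_card_iff.mpr ⟨⟨0, nsmul_zero 2⟩, ⟨t, ht⟩, ⟨t', ht'⟩,
        fun h ↦ ht0 (congrArg Subtype.val h).symm, fun h ↦ ht'0 (congrArg Subtype.val h).symm,
        fun h ↦ hne (congrArg Subtype.val h)⟩
    omega
  -- `2`-torsion points with nonzero reduction move by `0` or `P₁`; squares act trivially on `E[2]`
  have hmove : ∀ (σ : absoluteGaloisGroup K) (a : P), 2 • a = 0 → red₀ a ≠ 0 →
      σ • a - a = 0 ∨ σ • a - a = P₁ := by
    intro σ a h2a ha
    refine hA12 _ ?_ ?_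
    · rw [map_sub, sub_eq_zero]
      refine hTuniq _ _ ?_ ?_ (hstab' σ a ha) ha
      · rw [← map_nsmul, smul_comm, h2a, smul_zero, map_zero]
      · rw [← map_nsmul, h2a, map_zero]
    · rw [smul_sub, smul_comm, h2a, smul_zero, sub_zero]
  have hZp : ∀ a : P, 2 • a = 0 → ∀ σ : absoluteGaloisGroup K, (σ ^ 2) • a = a := by
    intro a h2a σ
    by_cases ha : red₀ a = 0
    · rcases hA12 a ha h2a with rfl | rfl
      · exact smul_zero _
      · exact hP₁fix _
    · have hb : σ • (σ • a - a) = σ • a - a := by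
        rcases hmove σ a h2a ha with h | h
        · rw [h, smul_zero]
        · rw [h, hP₁fix]
      rw [smul_sub] at hb
      rw [pow_two, mul_smul]
      have h2b : 2 • (σ • a - a) = 0 := by rw [smul_sub, smul_comm, h2a, smul_zero, sub_zero]
      have e1 : σ • σ • a = σ • a + (σ • a - a) := by rw [← hb]; abel
      rw [e1]
      have e2 : σ • a + (σ • a - a) = a + 2 • (σ • a - a) := by rw [two_nsmul]; abel
      rw [e2, h2b, add_zero]
  exact ⟨hstab, hdiv₁, P₁, hP₁0, hP₁two, hP₁ne, hP₁fix, hA12, hmove, hZp⟩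

/-! ### The Kummer endgame -/

variable {κ : ZpExtension ℚ 2}

set_option maxHeartbeats 800000 in
/-- **The KUMMER ENDGAME of the ε-step.** Let `κ` be cyclotomic, `v ∋ 2`, `K = ℚ_v`, `g ∈ H_n` a topological generator over
`H_∞`. Suppose given: a continuous character `a : H_{n+1} → ℤ/2`; a map `χ : Γ → ℤ/2` and `s ∈ K̄` with `s² = m ∈ ℤ`,
`m ≡ 3, 5 (mod 8)` and `σ s = (−1)^{χ σ} s` for every `σ ∈ Γ` (so `χ` is the Kummer character of `√m`); and the CONJUGATION
LAW `a(g⁻¹ τ g) = a(τ) + χ(τ)` for `τ ∈ H_{n+1}`. Then `False`: Hilbert 90 gives `β ≠ 0` with `τβ = (−1)^{a(τ)}β`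
(`τ ∈ H_{n+1}`); `θ := β · gβ · s` and `β²` are `H_{n+1}`-fixed with `θ² = β² · g(β²) · s²`, so `gθ = ±θ` and `f := β²s²/θ`
is `H_{n+1}`-fixed with `f · g(f) = ±m` — but no `H_{n+1}`-fixed `f` has `f · g(f)` a `2`-adic unit `≡ ±3 (mod 8)`
(NS2 BRICK 15 `MultTowerNS2.prod_smul_ne_pow_of_tateUnit` with `k = 0`, `R = 1`). [cite: NeukirchANT1999, Ch. V §1 Thm. (1.1)]
[cite: SerreLocalFields1979, X §1 Prop. 2] -/
theorem false_of_kummer_conjugation_law (hκ : κ.IsCyclotomic) (v : HeightOneSpectrum (𝓞 ℚ))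
    (h2v : ((2 : ℕ) : 𝓞 ℚ) ∈ v.asIdeal) (n : ℕ) {g : absoluteGaloisGroup (v.adicCompletion ℚ)}
    (hgn : g ∈ localSubgroup (κ.layerSubgroup n) (v.adicCompletion ℚ))
    (hgen : ∀ U : Subgroup (absoluteGaloisGroup (v.adicCompletion ℚ)),
      IsOpen (U : Set (absoluteGaloisGroup (v.adicCompletion ℚ))) →
        localSubgroup κ.kerSubgroup (v.adicCompletion ℚ) ≤ U → g ∈ U →
          localSubgroup (κ.layerSubgroup n) (v.adicCompletion ℚ) ≤ U)
    (a : localSubgroup (κ.layerSubgroup (n + 1)) (v.adicCompletion ℚ) → ZMod 2) (ha_cont : Continuous a)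
    (ha_add : ∀ σ ρ, a (σ * ρ) = a σ + a ρ)
    (χ : absoluteGaloisGroup (v.adicCompletion ℚ) → ZMod 2)
    (hlawZ : ∀ (σ : absoluteGaloisGroup (v.adicCompletion ℚ))
      (hσ : σ ∈ localSubgroup (κ.layerSubgroup (n + 1)) (v.adicCompletion ℚ))
      (hσ' : g⁻¹ * σ * g ∈ localSubgroup (κ.layerSubgroup (n + 1)) (v.adicCompletion ℚ)),
      a ⟨g⁻¹ * σ * g, hσ'⟩ = a ⟨σ, hσ⟩ + χ σ)
    {s : AlgebraicClosure (v.adicCompletion ℚ)} {m : ℤ} (hm8 : m % 8 = 3 ∨ m % 8 = 5)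
    (hs2m : s ^ 2 = algebraMap (v.adicCompletion ℚ) (AlgebraicClosure (v.adicCompletion ℚ))
      ((m : ℤ) : v.adicCompletion ℚ))
    (hσs : ∀ σ : absoluteGaloisGroup (v.adicCompletion ℚ), σ • s = if χ σ = 0 then s else -s) : False := by
  -- ### notation
  let K := v.adicCompletion ℚ
  let Kb := AlgebraicClosure (v.adicCompletion ℚ)
  let Hn1 : Subgroup (absoluteGaloisGroup K) := localSubgroup (κ.layerSubgroup (n + 1)) K
  haveI hHn1N : Hn1.Normal := by
    change (localSubgroup (κ.layerSubgroup (n + 1)) K).Normal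
    rw [localSubgroup_eq_comap]; exact Subgroup.Normal.comap inferInstance _
  have hconjmem' : ∀ σ : absoluteGaloisGroup K, σ ∈ Hn1 → g⁻¹ * σ * g ∈ Hn1 := fun σ hσ ↦ by
    have := hHn1N.conj_mem σ hσ g⁻¹
    rwa [inv_inv] at this
  have hsdiv : ∀ (σ : absoluteGaloisGroup K) (z₁ z₂ : Kb), σ • (z₁ / z₂) = σ • z₁ / σ • z₂ := fun σ z₁ z₂ ↦ by
    rw [div_eq_mul_inv, smul_mul', smul_inv'', div_eq_mul_inv]
  have hopen1 : IsOpen (Hn1 : Set (absoluteGaloisGroup K)) :=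
    MultTowerNS2.isOpen_localSubgroup _ (κ.isOpen_layerSubgroup (n + 1)) K
  obtain ⟨ug, hug⟩ := MultTowerSP1.exists_units_kappa_resGal_eq_of_generate hκ v h2v n hgn hgen
  have hg2 : g * g ∈ Hn1 := by
    have h := (MultTowerSP1.pow_mem_localSubgroup_layerSubgroup_iff (κ := κ) v n 1 hug 2).mpr (by norm_num)
    rwa [pow_two] at h
  -- the `2`-adic reading of `ℚ_v` (built BEFORE `CharZero ℚ_v` enters: that instance changes the preferred `Algebra ℚ ℚ_v`)
  haveI hfact : Fact (Nat.Prime (primesEquiv v : ℕ)) := ⟨(primesEquiv v).2⟩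
  have hp2 : ((primesEquiv v : Nat.Primes) : ℕ) = 2 := primesEquiv_eq_of_natCast_mem v Nat.prime_two h2v
  let e := (adicCompletion.padicEquiv v).toAlgEquiv.toRingEquiv
  have heq : ∀ k : ℤ, e ((k : ℤ) : K) =
      ((primesEquiv v : ℕ) : ℚ_[(primesEquiv v : ℕ)]) ^ 0 * (((k : ℤ) : ℤ_[(primesEquiv v : ℕ)]) : ℚ_[_]) :=
    fun k ↦ by rw [pow_zero, one_mul, map_intCast, PadicInt.coe_intCast]
  have hne0 : ∀ (k : ℤ) (ff : Kb), (∀ h ∈ Hn1, h • ff = ff) →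
      (toZModPow 3 ((k : ℤ) : ℤ_[(primesEquiv v : ℕ)]) = 3 ∨ toZModPow 3 ((k : ℤ) : ℤ_[(primesEquiv v : ℕ)]) = 5) →
      ff * (g • ff) ≠ algebraMap K Kb ((k : ℤ) : K) := by
    intro k ff hff hk habs
    have hprod : (∏ i ∈ Finset.range (2 ^ 1), (g ^ i) • ff) = ff * (g • ff) := by
      rw [pow_one, Finset.prod_range_succ, Finset.prod_range_succ, Finset.prod_range_zero, one_mul, pow_zero, one_smul,
        pow_one]
    have h := MultTowerNS2.prod_smul_ne_pow_of_tateUnit hκ v h2v (primesEquiv v : ℕ) hp2 e (heq k) hk n hug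
      (R := 1) le_rfl (a := 1) odd_one (f := ff) hff
    rw [hprod, pow_zero, one_mul, pow_one] at h
    exact h habs
  obtain ⟨hum, hunm⟩ := toZModPow_three_intCast_of_emod_eight (primesEquiv v : ℕ) hp2 m hm8
  -- ### Hilbert 90: the Kummer generator `β` of `a` on `H_{n+1}`
  haveI : CharZero K := charZero_of_injective_algebraMap (algebraMap ℚ K).injective
  have hsne : s ≠ 0 := by
    intro hs
    rw [hs, zero_pow two_ne_zero, eq_comm, map_eq_zero_iff _ (algebraMap K Kb).injective, Int.cast_eq_zero] at hs2m
    rw [hs2m] at hm8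
    omega
  obtain ⟨β, hβ0, hβ⟩ := exists_smul_eq_ite_neg_of_contHom K Hn1 hopen1 a ha_cont ha_add
  -- ### `θ = β · gβ · s`, `β²`, and `f = β² s² / θ`
  have hτβ : ∀ (σ : absoluteGaloisGroup K) (hσ : σ ∈ Hn1),
      σ • β = if a ⟨σ, hσ⟩ = 0 then β else -β := fun σ hσ ↦ hβ ⟨σ, hσ⟩
  have hτgβ : ∀ (σ : absoluteGaloisGroup K) (hσ : σ ∈ Hn1),
      σ • (g • β) = if a ⟨σ, hσ⟩ + χ σ = 0 then g • β else -(g • β) := by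
    intro σ hσ
    have hdec : σ • (g • β) = g • ((g⁻¹ * σ * g) • β) := by
      rw [← mul_smul, ← mul_smul]; congr 1; group
    rw [hdec, hβ ⟨g⁻¹ * σ * g, hconjmem' σ hσ⟩, hlawZ σ hσ (hconjmem' σ hσ)]
    split_ifs
    · rfl
    · exact smul_neg g β
  have hZ01 : ∀ z : ZMod 2, z = 0 ∨ z = 1 := fun z ↦ by
    fin_cases z
    · exact Or.inl rfl
    · exact Or.inr rfl
  have h10 : (1 : ZMod 2) ≠ 0 := one_ne_zero
  obtain ⟨θ, hθ_def⟩ : ∃ θ' : Kb, θ' = β * (g • β) * s := ⟨_, rfl⟩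
  have hθfix : ∀ σ ∈ Hn1, σ • θ = θ := by
    intro σ hσ
    rw [hθ_def, smul_mul', smul_mul', hτβ σ hσ, hτgβ σ hσ, hσs σ]
    rcases hZ01 (a ⟨σ, hσ⟩) with h0 | h1 <;> rcases hZ01 (χ σ) with k0 | k1
    · rw [h0, k0, add_zero, if_pos rfl, if_pos rfl, if_pos rfl]
    · rw [h0, k1, zero_add, if_pos rfl, if_neg h10, if_neg h10]; ring
    · rw [h1, k0, add_zero, if_neg h10, if_neg h10, if_pos rfl]; ring
    · rw [h1, k1, show (1 : ZMod 2) + 1 = 0 from rfl, if_neg h10, if_pos rfl, if_neg h10]; ring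
  have hβ2fix : ∀ σ ∈ Hn1, σ • (β ^ 2) = β ^ 2 := by
    intro σ hσ
    rw [smul_pow', hτβ σ hσ]
    split_ifs
    · rfl
    · ring
  have hs2fix : ∀ σ : absoluteGaloisGroup K, σ • (s ^ 2) = s ^ 2 := fun σ ↦ by
    rw [smul_pow', hσs σ]; split_ifs <;> ring
  have hθ2 : θ ^ 2 = β ^ 2 * (g • (β ^ 2)) * s ^ 2 := by rw [hθ_def, smul_pow']; ring
  have hgθ2 : (g • θ) ^ 2 = θ ^ 2 := by
    rw [← smul_pow', hθ2, smul_mul', smul_mul', hs2fix, ← mul_smul, hβ2fix _ hg2]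
    ring
  have hgβ0 : g • β ≠ 0 := fun h ↦ hβ0 (by
    have := congrArg (fun z ↦ g⁻¹ • z) h
    simpa only [← mul_smul, inv_mul_cancel, one_smul, smul_zero] using this)
  have hθ0 : θ ≠ 0 := by
    rw [hθ_def]; exact mul_ne_zero (mul_ne_zero hβ0 hgβ0) hsne
  have hgθ : g • θ = θ ∨ g • θ = -θ := sq_eq_sq_iff_eq_or_eq_neg.mp hgθ2
  obtain ⟨f, hf_def⟩ : ∃ f' : Kb, f' = β ^ 2 * s ^ 2 / θ := ⟨_, rfl⟩
  have hffix : ∀ σ ∈ Hn1, σ • f = f := fun σ hσ ↦ by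
    rw [hf_def, hsdiv, smul_mul', hβ2fix σ hσ, hs2fix, hθfix σ hσ]
  have hfgf : f * (g • f) = β ^ 2 * (g • (β ^ 2)) * s ^ 2 * s ^ 2 / (θ * (g • θ)) := by
    rw [hf_def, hsdiv, smul_mul', hs2fix]
    rw [div_mul_div_comm]; ring
  -- ### the contradiction with the tower non-norm lemma (NS2 BRICK 15)
  have hne : ∀ k : ℤ, (toZModPow 3 ((k : ℤ) : ℤ_[(primesEquiv v : ℕ)]) = 3 ∨
      toZModPow 3 ((k : ℤ) : ℤ_[(primesEquiv v : ℕ)]) = 5) →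
      f * (g • f) ≠ algebraMap K Kb ((k : ℤ) : K) := fun k hk ↦ hne0 k f hffix hk
  have hA : β ^ 2 * (g • (β ^ 2)) * s ^ 2 ≠ 0 := by rw [← hθ2]; exact pow_ne_zero 2 hθ0
  rcases hgθ with hgθ' | hgθ'
  · -- `gθ = θ`: `f · gf = s² = m`
    refine hne m hum ?_
    rw [hfgf, hgθ', ← pow_two, hθ2, ← hs2m]
    exact mul_div_cancel_left₀ (s ^ 2) hA
  · -- `gθ = −θ`: `f · gf = −s² = −m`
    refine hne (-m) hunm ?_
    have hneg : algebraMap K Kb (((-m : ℤ) : ℤ) : K) = -(s ^ 2) := by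
      rw [Int.cast_neg, map_neg, ← hs2m]
    rw [hneg, hfgf, hgθ', mul_neg, ← pow_two, hθ2, div_neg, mul_div_cancel_left₀ (s ^ 2) hA]

end Summit.BirchSwinnertonDyer.BirchSwinnertonDyer.Theorems.GoodOrdTower

end
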